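import Mathlib
import HarnessLib

/-!
# Langlands' finite-model gluing map `Θ_A` and its planar, coin-resolved variant
(`langlandsGlue`, `planarCoinGlue`)

Topic `Literature/Probability/Percolation`. Definition request `defn-PlanarCoinGlue` (route
CriticalPhenomena/CardyFormulaZ2/CardyGluingRDE, crux `GluingStability`), together with the
finite state space it acts on (`BoxArcState`, request `defn-BoxArcState`, combinatorial part).

## The source construction (Langlands–Pouliot–Saint-Aubin 1994, §2.3; Langlands–Lafortune 1994)

"Let `S` be a square whose sides have been divided in `l` equal intervals. There are
`4l(4l+1)/2` pairs of intervals. … A configuration `x` for this model is obtained by specifying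
which pairs are connected and which ones are not. … The space `A` of configurations is then a set
of functions from `𝒫` to `{+1, -1}`. … There is a natural transformation `Θ_A : A × A × A × A → A`
…. To construct `Θ_A` one first juxtaposes four elements of `A` so that they form a larger square
with `2l` subdivisions on its sides. These intervals are then fused in pairs so that each side of
the larger square contains `l` intervals. Finally these new intervals are connected by composing
the "paths". Suppose, for example, that `α` and `β` are connected intervals in one of the original
squares and `μ` and `ν` are also connected in another one. If `β` and `μ` turn out to be in the
interior of the larger square formed upon juxtaposition and are coincident, then the larger
intervals containing `α` and `ν` in this square will be connected." (LPSA 1994 §2.3, arXiv p. 12.)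
"If `𝔛` is the set of measures on `A`, `Θ_A` can be used to define a map `Θ_𝔛 : 𝔛 → 𝔛`. Since `𝔛`
is a simplex in a finite-dimensional space, the question of finding fixed points of `Θ_𝔛` and
studying their nature is well-posed." (ibid.)

## What is defined here

* Indexing. A square at resolution `k` has `4k` closed boundary segments `Fin 4 × Fin k`:
  side `d` (`0` bottom, `1` right, `2` top, `3` left — counterclockwise, the side labels of the
  route file) and position `t` counted COUNTERCLOCKWISE along the boundary (bottom: left → right,
  right: bottom → top, top: right → left, left: top → bottom). With this convention the quarter
  turn acts by `(d, t) ↦ (d + 1, t)` (`segRot`) and the reflection in the vertical axis by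
  `(d, t) ↦ (-d, rev t)` (`segRefl`). (The route's coordinate parametrisation `seg` agrees on
  sides `0, 1` and is reversed on sides `2, 3`.)
* `BoxArcState k`: a pair (primal, dual) of Boolean "joined inside the window" matrices on the
  `4k` segments (Langlands' `A`, one copy for the open and one for the closed-dual connections);
  a `Fintype` with `DecidableEq` and the discrete σ-algebra, so that laws are points of a finite
  simplex; the quarter turn `rot`, the reflection `refl`, the duality involution `swap`, and the
  pairwise-OR coarsening `fuse : (2k-resolution matrix) → (k-resolution matrix)`.
* The `2 × 2` juxtaposition. Quadrant `q : Fin 4` is the sub-square at the big corner where big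
  side `q` starts (`0` = SW, `1` = SE, `2` = NE, `3` = NW); its sides `q` and `q + 3` are outer,
  its sides `q + 1`, `q + 2` interior. Nodes `GlueNode k = Fin 4 × (Fin 4 × Fin k)` (quadrant,
  segment). The `4k` interior ARCS `Fin 4 × Fin k` = (half-seam `h` between quadrants `h` and
  `h + 1`, distance `j` from the centre) have the two coincident endpoints
  `arcFst (h, j) = (h, (h + 1, rev j))` and `arcSnd (h, j) = (h + 1, (h + 3, j))`; the `8k` outer
  half-segments `(d, p)`, `p : Fin (2k)` counterclockwise, are the nodes `outerNode (d, p)`.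
* `GlueLink X g` (one species `X : Fin 4 → matrix`, gates `g : arcs → Bool`): "joined inside a
  quadrant" or "the two endpoints of an open arc"; chaining = its equivalence closure
  `Relation.EqvGen` (as in the route's `JunctionShadowing`); `chainRel` reads it on outer
  half-segments and `glueSpecies X g = fuse (chainRel X g)`.
* `langlandsGlue M = glueSpecies M (fun _ ↦ true)`: Langlands' `Θ_A` (all arcs open).
* `planarCoinGlue S ξ` (THE REQUESTED MAP, the route planner's planar and duality-symmetric
  correction of `Θ_A`, not in the sources): primal and dual matrices are chained separately; an
  arc is CONTESTED when both species pass through it (each is joined, inside the quadrant on each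
  side of the arc, to some other segment); at a contested arc the fair coin `ξ a` awards the
  crossing to exactly one species (primal iff `ξ a = true`, dual iff `ξ a = false` — primal XOR
  dual); uncontested arcs stay open to both (the idle species' link is inert there). One coin per
  arc, indexed by (half-seam, distance from the centre), is a `D₄`-equivariant bookkeeping of "the
  next fresh coin in a fixed scan order" with the same law. Proved API: `planarCoinGlue_swap`
  (duality equivariance: swap the species and negate the coins), `planarCoinGlue_primal_of_true` /
  `planarCoinGlue_dual_of_false` (constant coins = the raw Langlands rule for the winning species),
  `planarCoinGlue_rot` / `planarCoinGlue_refl` (equivariance under the quarter turn and the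
  reflection, i.e. under the dihedral group of the square), `planarCoinGlue_symm` (the glued
  matrices are symmetric), measurability of the uncurried map (`measurable_planarCoinGlueMap`).
* Packaging for the law-level map `gluingRDE` of `GluingRDE.lean` (request `defn-GluingRDE`,
  in tree): the symmetries as equivalences (`BoxArcState.rotEquiv/reflEquiv/swapEquiv`, the
  generators `BoxArcState.symmetryGen` of `D₄ × ℤ/2`) and the slot / coin relabellings
  `quadRot/quadRefl`, `coinRot/coinRefl/coinNot` under which `planarCoinGlue` is equivariant. The
  route's `Ψ_k` is `gluingRDE planarCoinGlue (PMF.uniformOfFintype (Fin 4 × Fin k → Bool))`; that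
  it maps the symmetric sector `symmetricSector (BoxArcState.symmetryGen k)` to itself follows
  from the equivariance theorems here through `IsGlueSymmetry.of_uniform` and
  `mapsTo_gluingRDE_symmetricSector` (companion file `PlanarCoinGlueRDE.lean`).

Not here: the reading maps from bond/site configurations (G02 `discreteCrossing` / `triCrossing`)
and block families (request `defn-BoxArcState`), the multiresolution metric (`defn-MultiResTV`),
and any planarity-preservation or contraction statement for the output (route items).

## References

* R. Langlands, P. Pouliot, Y. Saint-Aubin, *Conformal invariance in two-dimensional percolation*,
  Bull. AMS 30 (1994) 1–61, §2.3 (arXiv:math/9401222 pp. 11–12). [LanglandsPouliotSaintaubin1994]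
* R. P. Langlands, M.-A. Lafortune, *Finite models for percolation*, Contemp. Math. 177 (1994)
  227–246. [LanglandsLafortune1994]
-/

namespace Literature.Probability.Percolation

open _root_.MeasureTheory

/-! ### Resolution-`k` states of a square window -/

/-- Boolean "joined" matrices on the `4k` boundary segments `Fin 4 × Fin k` (side, counterclockwise
position) of a square at resolution `k` — Langlands' configurations `𝒫 → {±1}`.
[cite: LanglandsPouliotSaintaubin1994, §2.3] -/
abbrev ArcRel (k : ℕ) : Type := Fin 4 × Fin k → Fin 4 × Fin k → Bool

/-- **Resolution-`k` state of a square window** (Langlands' configuration space `A`, doubled):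
`primal a b` records "boundary segments `a` and `b` are joined by an open path inside the window",
`dual a b` the same for closed dual paths; segments are indexed by `Fin 4 × Fin k` = (side,
counterclockwise position). No symmetry or planarity constraint is imposed on the carrier (they
are properties of the states actually read from configurations).
[cite: LanglandsPouliotSaintaubin1994, §2.3] -/
@[ext]
structure BoxArcState (k : ℕ) where
  /-- primal (open) connections between boundary segments -/
  primal : ArcRel k
  /-- dual (closed) connections between boundary segments -/
  dual : ArcRel k
  deriving DecidableEq

namespace BoxArcState

variable {k : ℕ}

/-- A state is a pair of matrices. [folklore] -/
def equivProd (k : ℕ) : BoxArcState k ≃ ArcRel k × ArcRel k where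
  toFun s := (s.primal, s.dual)
  invFun p := ⟨p.1, p.2⟩
  left_inv _ := rfl
  right_inv _ := rfl

/-- The state space is finite (`2 ^ (2 (4k)²)` points). [folklore] -/
instance instFintype : Fintype (BoxArcState k) := Fintype.ofEquiv _ (equivProd k).symm

/-- The discrete σ-algebra: laws of states are points of a finite simplex. [folklore] -/
instance instMeasurableSpace : MeasurableSpace (BoxArcState k) := ⊤

/-- Every set of states is measurable. [folklore] -/
instance instDiscreteMeasurableSpace : DiscreteMeasurableSpace (BoxArcState k) :=
  ⟨fun _ => trivial⟩

/-- The duality involution: exchange the primal and the dual matrix. [folklore] -/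
def swap (s : BoxArcState k) : BoxArcState k := ⟨s.dual, s.primal⟩

/-- `swap` is an involution. [folklore] -/
@[simp] theorem swap_swap (s : BoxArcState k) : s.swap.swap = s := rfl

end BoxArcState

/-! ### The dihedral generators on segment indices -/

section Indexing

variable {k : ℕ}

/-- Quarter turn on segment indices: side `d ↦ d + 1`, counterclockwise position unchanged.
[folklore] -/
def segRot (a : Fin 4 × Fin k) : Fin 4 × Fin k := (a.1 + 1, a.2)

/-- Reflection in the vertical axis on segment indices: bottom and top are reversed in place,
left and right are exchanged: side `d ↦ -d`, position `t ↦ rev t`. [folklore] -/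
def segRefl (a : Fin 4 × Fin k) : Fin 4 × Fin k := (-a.1, a.2.rev)

/-- Pull back a segment matrix along a map of segment indices. [folklore] -/
def relComap {ι κ : Type*} (f : ι → κ) (M : κ → κ → Bool) : ι → ι → Bool := fun a b => M (f a) (f b)

/-- Unfolding `relComap`. [folklore] -/
@[simp] theorem relComap_apply {ι κ : Type*} (f : ι → κ) (M : κ → κ → Bool) (a b : ι) :
    relComap f M a b = M (f a) (f b) := rfl

end Indexing

namespace BoxArcState

variable {k : ℕ}

/-- The quarter turn on states (both matrices pulled back along `segRot`). [folklore] -/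
def rot (s : BoxArcState k) : BoxArcState k := ⟨relComap segRot s.primal, relComap segRot s.dual⟩

/-- The reflection on states (both matrices pulled back along `segRefl`). [folklore] -/
def refl (s : BoxArcState k) : BoxArcState k :=
  ⟨relComap segRefl s.primal, relComap segRefl s.dual⟩

/-- Unfolding `rot`. [folklore] -/
@[simp] theorem rot_primal (s : BoxArcState k) : s.rot.primal = relComap segRot s.primal := rfl

/-- Unfolding `rot`. [folklore] -/
@[simp] theorem rot_dual (s : BoxArcState k) : s.rot.dual = relComap segRot s.dual := rfl

/-- Unfolding `refl`. [folklore] -/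
@[simp] theorem refl_primal (s : BoxArcState k) : s.refl.primal = relComap segRefl s.primal := rfl

/-- Unfolding `refl`. [folklore] -/
@[simp] theorem refl_dual (s : BoxArcState k) : s.refl.dual = relComap segRefl s.dual := rfl

/-- Unfolding `swap`. [folklore] -/
@[simp] theorem swap_primal (s : BoxArcState k) : s.swap.primal = s.dual := rfl

/-- Unfolding `swap`. [folklore] -/
@[simp] theorem swap_dual (s : BoxArcState k) : s.swap.dual = s.primal := rfl

/-- `refl` is an involution. [folklore] -/
@[simp] theorem refl_refl (s : BoxArcState k) : s.refl.refl = s := by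
  ext a b <;> simp [refl, segRefl]

/-- Four quarter turns are the identity. [folklore] -/
theorem rot_rot_rot_rot (s : BoxArcState k) : s.rot.rot.rot.rot = s := by
  have h4 : ∀ d : Fin 4, d + 1 + 1 + 1 + 1 = d := by decide
  ext a b <;> simp [rot, segRot, h4]

end BoxArcState

/-! ### The `2 × 2` juxtaposition: nodes, interior arcs, outer half-segments, fusion -/

section Juxtaposition

variable {k : ℕ}

/-- Nodes of the gluing graph: (quadrant, segment of that quadrant). Quadrant `q` sits at the
big corner where big side `q` starts (`0` SW, `1` SE, `2` NE, `3` NW). [folklore] -/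
abbrev GlueNode (k : ℕ) : Type := Fin 4 × (Fin 4 × Fin k)

/-- First endpoint of the interior arc `(h, j)` (half-seam `h` = between quadrants `h` and
`h + 1`, `j` = distance from the centre): segment `rev j` of side `h + 1` of quadrant `h`.
[cite: LanglandsPouliotSaintaubin1994, §2.3] -/
def arcFst (a : Fin 4 × Fin k) : GlueNode k := (a.1, (a.1 + 1, a.2.rev))

/-- Second endpoint of the interior arc `(h, j)`: the coincident segment `j` of side `h + 3` of
quadrant `h + 1`. [cite: LanglandsPouliotSaintaubin1994, §2.3] -/
def arcSnd (a : Fin 4 × Fin k) : GlueNode k := (a.1 + 1, (a.1 + 3, a.2))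

/-- The outer half-segment `(d, p)` of the big square (`p : Fin (2k)` counterclockwise along big
side `d`) as a node: the first half of big side `d` is side `d` of quadrant `d`, the second half
is side `d` of quadrant `d + 1`. [cite: LanglandsPouliotSaintaubin1994, §2.3] -/
def outerNode (u : Fin 4 × Fin (2 * k)) : GlueNode k :=
  if h : (u.2 : ℕ) < k then (u.1, (u.1, ⟨u.2, h⟩))
  else (u.1 + 1, (u.1, ⟨u.2 - k, by omega⟩))

/-- The two halves `2t, 2t + 1` of the fused segment `t`. [folklore] -/
def dbl (t : Fin k) (i : Fin 2) : Fin (2 * k) := ⟨2 * t + i, by omega⟩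

/-- **Fusion in pairs** (also the coarsening map from resolution `2k` to resolution `k`): the
fused segments `a`, `b` are joined iff some half of `a` is joined to some half of `b`.
[cite: LanglandsPouliotSaintaubin1994, §2.3] -/
def fuse (R : ArcRel (2 * k)) :
    ArcRel k :=
  fun a b => decide (∃ i j : Fin 2, R (a.1, dbl a.2 i) (b.1, dbl b.2 j) = true)

/-- Coarsening of states from resolution `2k` to `k` (fusion of both matrices). [folklore] -/
def BoxArcState.coarsen (s : BoxArcState (2 * k)) : BoxArcState k := ⟨fuse s.primal, fuse s.dual⟩

/-- **Links of one species.** `X q` is the matrix of that species in quadrant `q`, `g` says which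
interior arcs are open to it: two nodes are linked iff they are segments of the same quadrant
joined inside it, or the two coincident endpoints of an open arc ("composition of paths through
coincident interior intervals"). [cite: LanglandsPouliotSaintaubin1994, §2.3] -/
def GlueLink (X : Fin 4 → ArcRel k) (g : Fin 4 × Fin k → Bool)
    (x y : GlueNode k) : Prop :=
  (x.1 = y.1 ∧ X x.1 x.2 y.2 = true) ∨
    ∃ a, g a = true ∧ (x = arcFst a ∧ y = arcSnd a ∨ x = arcSnd a ∧ y = arcFst a)

open scoped Classical in
/-- The chained relation read on the outer half-segments of the big square: the equivalence
closure of `GlueLink X g`. [cite: LanglandsPouliotSaintaubin1994, §2.3] -/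
noncomputable def chainRel (X : Fin 4 → ArcRel k)
    (g : Fin 4 × Fin k → Bool) : ArcRel (2 * k) :=
  fun u v => decide (Relation.EqvGen (GlueLink X g) (outerNode u) (outerNode v))

/-- Gluing of ONE species through the open arcs: juxtapose, chain, read the outer half-segments,
fuse in pairs. [cite: LanglandsPouliotSaintaubin1994, §2.3] -/
noncomputable def glueSpecies (X : Fin 4 → ArcRel k)
    (g : Fin 4 × Fin k → Bool) : ArcRel k :=
  fuse (chainRel X g)

/-- **Langlands' `Θ_A : A⁴ → A`** on connection matrices: all interior arcs open.
[cite: LanglandsPouliotSaintaubin1994, §2.3] -/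
noncomputable def langlandsGlue (M : Fin 4 → ArcRel k) :
    ArcRel k :=
  glueSpecies M fun _ => true

/-- Species `X` PASSES through node `x = (q, s)`: inside quadrant `q`, segment `s` is joined to
some other segment. [folklore] -/
def Passes (X : Fin 4 → ArcRel k) (x : GlueNode k) : Prop :=
  ∃ y, y ≠ x.2 ∧ X x.1 x.2 y = true

/-- The arc `a` is CONTESTED between species `X` (first) and `Y` (second): both pass through both
of its endpoints, so that chaining both through `a` would let a primal and a dual chain cross the
seam at the same arc. [folklore] -/
def Contested (X Y : Fin 4 → ArcRel k) (a : Fin 4 × Fin k) : Prop :=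
  (Passes X (arcFst a) ∧ Passes X (arcSnd a)) ∧ (Passes Y (arcFst a) ∧ Passes Y (arcSnd a))

/-- `Contested` is symmetric in the two species. [folklore] -/
theorem contested_comm (X Y : Fin 4 → ArcRel k) (a : Fin 4 × Fin k) :
    Contested X Y a ↔ Contested Y X a := and_comm

/-- The gate of species `X` against `Y` with coins `ξ`: arc `a` is open to `X` unless it is
contested and the coin is against `X`. [folklore] -/
noncomputable def gate (X Y : Fin 4 → ArcRel k)
    (ξ : Fin 4 × Fin k → Bool) (a : Fin 4 × Fin k) : Bool :=
  open scoped Classical in !decide (Contested X Y a) || ξ a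

/-- **The planar coin-resolved gluing map** `PlanarCoinGlue_k : (Fin 4 → BoxArcState k) →
(Fin 4 × Fin k → Bool) → BoxArcState k` (route CardyGluingRDE's correction of Langlands' `Θ_A`):
the four states `S q` sit in the quadrants of a `2 × 2` square; primal matrices are chained
through the arcs open to the primal species and dual matrices through the arcs open to the dual
species, where a contested arc `a` is open to the primal species iff `ξ a = true` and to the dual
species iff `ξ a = false` (one fair coin per arc, primal XOR dual), an uncontested arc to both;
then the outer half-segments are read and fused in pairs. The coin index `(h, j)` = (half-seam,
distance from the centre) makes the bookkeeping `D₄`-equivariant. Provenance: the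
juxtapose–compose–fuse skeleton is Langlands' `Θ_A` [cite: LanglandsPouliotSaintaubin1994, §2.3];
the primal/dual doubling and the coin resolution of contested arcs are the modification posited
by route CriticalPhenomena/CardyFormulaZ2/CardyGluingRDE (request `defn-PlanarCoinGlue`), not in
the source. -/
noncomputable def planarCoinGlue (S : Fin 4 → BoxArcState k) (ξ : Fin 4 × Fin k → Bool) :
    BoxArcState k where
  primal := glueSpecies (fun q => (S q).primal)
    (gate (fun q => (S q).primal) (fun q => (S q).dual) ξ)
  dual := glueSpecies (fun q => (S q).dual)
    (gate (fun q => (S q).dual) (fun q => (S q).primal) fun a => !ξ a)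

/-- The uncurried gluing map on (four states, coins), the form pushed forward in the gluing RDE
`Ψ_k(μ) = (planarCoinGlueMap)_* (μ^{⊗ 4} ⊗ Ber(1/2)^{⊗ 4k})`. [folklore] -/
noncomputable def planarCoinGlueMap (k : ℕ) :
    (Fin 4 → BoxArcState k) × (Fin 4 × Fin k → Bool) → BoxArcState k :=
  fun p => planarCoinGlue p.1 p.2

/-- The gluing map is measurable (all types are finite and discrete). [folklore] -/
theorem measurable_planarCoinGlueMap (k : ℕ) : Measurable (planarCoinGlueMap k) :=
  measurable_of_finite _

/-! ### Duality equivariance and the raw rule as a specialisation -/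

/-- **Duality equivariance**: exchanging primal and dual in the four inputs and negating every
coin exchanges primal and dual in the output. [folklore] -/
theorem planarCoinGlue_swap (S : Fin 4 → BoxArcState k) (ξ : Fin 4 × Fin k → Bool) :
    planarCoinGlue (fun q => (S q).swap) (fun a => !ξ a) = (planarCoinGlue S ξ).swap := by
  ext : 1
  · rfl
  · simp only [planarCoinGlue, Bool.not_not, BoxArcState.swap]

/-- With all coins `true` the primal species wins every contest: the primal output is Langlands'
raw rule `Θ_A` applied to the four primal matrices. [cite: LanglandsPouliotSaintaubin1994, §2.3] -/
theorem planarCoinGlue_primal_of_true (S : Fin 4 → BoxArcState k) :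
    (planarCoinGlue S fun _ => true).primal = langlandsGlue fun q => (S q).primal := by
  simp only [planarCoinGlue, langlandsGlue]
  congr 1
  funext a
  simp [gate]

/-- With all coins `false` the dual species wins every contest: the dual output is `Θ_A` applied
to the four dual matrices. [cite: LanglandsPouliotSaintaubin1994, §2.3] -/
theorem planarCoinGlue_dual_of_false (S : Fin 4 → BoxArcState k) :
    (planarCoinGlue S fun _ => false).dual = langlandsGlue fun q => (S q).dual := by
  simp only [planarCoinGlue, langlandsGlue]
  congr 1
  funext a
  simp [gate]

/-- At an uncontested arc the gate is open whatever the coin. [folklore] -/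
theorem gate_of_not_contested {X Y : Fin 4 → ArcRel k}
    {a : Fin 4 × Fin k} (h : ¬ Contested X Y a) (ξ : Fin 4 × Fin k → Bool) :
    gate X Y ξ a = true := by
  classical
  simp [gate, h]

/-- At a contested arc the gate of the first species is the coin. [folklore] -/
theorem gate_of_contested {X Y : Fin 4 → ArcRel k}
    {a : Fin 4 × Fin k} (h : Contested X Y a) (ξ : Fin 4 × Fin k → Bool) : gate X Y ξ a = ξ a := by
  classical
  simp [gate, h]

/-! ### Quarter-turn equivariance -/

/-- Transport of an equivalence closure along a bijection. [folklore] -/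
theorem eqvGen_iff_of_equiv {α β : Type*} (e : α ≃ β) {s : α → α → Prop} {r : β → β → Prop}
    (h : ∀ x y, s x y ↔ r (e x) (e y)) (a b : α) :
    Relation.EqvGen s a b ↔ Relation.EqvGen r (e a) (e b) := by
  constructor
  · intro hab
    induction hab with
    | rel x y hxy => exact .rel _ _ ((h x y).1 hxy)
    | refl x => exact .refl _
    | symm x y _ ih => exact .symm _ _ ih
    | trans x y z _ _ ih₁ ih₂ => exact .trans _ _ _ ih₁ ih₂
  · suffices H : ∀ u v, Relation.EqvGen r u v → Relation.EqvGen s (e.symm u) (e.symm v) by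
      intro hab
      simpa using H _ _ hab
    intro u v huv
    induction huv with
    | rel x y hxy => exact .rel _ _ ((h _ _).2 (by simpa using hxy))
    | refl x => exact .refl _
    | symm x y _ ih => exact .symm _ _ ih
    | trans x y z _ _ ih₁ ih₂ => exact .trans _ _ _ ih₁ ih₂

/-- The quarter turn on nodes: quadrant `q ↦ q + 1`, segment `segRot`. [folklore] -/
def nodeRot : GlueNode k ≃ GlueNode k where
  toFun x := (x.1 + 1, segRot x.2)
  invFun x := (x.1 - 1, (x.2.1 - 1, x.2.2))
  left_inv x := by simp [segRot]
  right_inv x := by simp [segRot]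

/-- The quarter turn on arc (and coin) indices: half-seam `h ↦ h + 1`. [folklore] -/
def arcRot : Fin 4 × Fin k ≃ Fin 4 × Fin k where
  toFun a := (a.1 + 1, a.2)
  invFun a := (a.1 - 1, a.2)
  left_inv a := by simp
  right_inv a := by simp

/-- Unfolding `nodeRot`. [folklore] -/
@[simp] theorem nodeRot_apply (x : GlueNode k) : nodeRot x = (x.1 + 1, segRot x.2) := rfl

/-- Unfolding `arcRot`. [folklore] -/
@[simp] theorem arcRot_apply (a : Fin 4 × Fin k) : arcRot a = (a.1 + 1, a.2) := rfl

/-- Unfolding `segRot`. [folklore] -/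
@[simp] theorem segRot_apply (a : Fin 4 × Fin k) : segRot a = (a.1 + 1, a.2) := rfl

/-- The quarter turn maps the first endpoint of an arc to the first endpoint of the turned arc.
[folklore] -/
theorem nodeRot_arcFst (a : Fin 4 × Fin k) : nodeRot (arcFst a) = arcFst (arcRot a) := by
  simp [arcFst]

/-- The quarter turn maps the second endpoint of an arc to the second endpoint of the turned arc.
[folklore] -/
theorem nodeRot_arcSnd (a : Fin 4 × Fin k) : nodeRot (arcSnd a) = arcSnd (arcRot a) := by
  simp only [nodeRot_apply, arcSnd, segRot_apply, arcRot_apply, Prod.mk.injEq, and_true, true_and]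
  exact add_right_comm _ _ _

/-- The quarter turn maps outer half-segment `(d, p)` to `(d + 1, p)`. [folklore] -/
theorem nodeRot_outerNode (u : Fin 4 × Fin (2 * k)) :
    nodeRot (outerNode u) = outerNode (u.1 + 1, u.2) := by
  unfold outerNode
  by_cases h : (u.2 : ℕ) < k
  · simp [h]
  · simp [h]

/-- The four matrices of one species seen after a quarter turn of the `2 × 2` picture: quadrant
`q` carries the pulled-back matrix of quadrant `q + 1`. [folklore] -/
def speciesRot (X : Fin 4 → ArcRel k) :
    Fin 4 → ArcRel k :=
  fun q => relComap segRot (X (q + 1))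

/-- The links of the turned picture are the turned links. [folklore] -/
theorem glueLink_rot (X : Fin 4 → ArcRel k) (g : Fin 4 × Fin k → Bool)
    (x y : GlueNode k) :
    GlueLink (speciesRot X) (g ∘ arcRot) x y ↔ GlueLink X g (nodeRot x) (nodeRot y) := by
  unfold GlueLink
  apply or_congr
  · simp [speciesRot]
  · refine arcRot.exists_congr fun a => ?_
    simp only [Function.comp_apply, ← nodeRot_arcFst, ← nodeRot_arcSnd,
      nodeRot.apply_eq_iff_eq]

/-- `Passes` is turned along with the picture. [folklore] -/
theorem passes_rot (X : Fin 4 → ArcRel k) (x : GlueNode k) :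
    Passes (speciesRot X) x ↔ Passes X (nodeRot x) := by
  have hinj : Function.Injective (segRot (k := k)) := arcRot.injective
  refine arcRot.exists_congr fun y => ?_
  simp only [speciesRot, relComap_apply, nodeRot_apply]
  exact and_congr_left' (hinj.ne_iff (x := y) (y := x.2)).symm

/-- An arc of the turned picture is contested iff the turned arc is. [folklore] -/
theorem contested_rot (X Y : Fin 4 → ArcRel k) (a : Fin 4 × Fin k) :
    Contested (speciesRot X) (speciesRot Y) a ↔ Contested X Y (arcRot a) := by
  simp only [Contested, passes_rot, nodeRot_arcFst, nodeRot_arcSnd]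

/-- The gates of the turned picture with turned coins are the turned gates. [folklore] -/
theorem gate_rot (X Y : Fin 4 → ArcRel k) (ξ : Fin 4 × Fin k → Bool) :
    gate (speciesRot X) (speciesRot Y) (ξ ∘ arcRot) = gate X Y ξ ∘ arcRot := by
  classical
  funext a
  simp only [gate, Function.comp_apply, contested_rot]

/-- The chained outer relation of the turned picture is the turned chained relation.
[folklore] -/
theorem chainRel_rot (X : Fin 4 → ArcRel k) (g : Fin 4 × Fin k → Bool)
    (u v : Fin 4 × Fin (2 * k)) :
    chainRel (speciesRot X) (g ∘ arcRot) u v = chainRel X g (u.1 + 1, u.2) (v.1 + 1, v.2) := by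
  classical
  unfold chainRel
  rw [← nodeRot_outerNode, ← nodeRot_outerNode]
  refine decide_eq_decide.mpr ?_
  exact eqvGen_iff_of_equiv nodeRot (glueLink_rot X g) _ _

/-- Fusion commutes with the quarter turn. [folklore] -/
theorem fuse_rot (R : ArcRel (2 * k)) :
    fuse (fun u v => R (u.1 + 1, u.2) (v.1 + 1, v.2)) = relComap segRot (fuse R) := by
  funext a b
  simp [fuse]

/-- Quarter-turn equivariance of the one-species gluing. [folklore] -/
theorem glueSpecies_rot (X : Fin 4 → ArcRel k)
    (g : Fin 4 × Fin k → Bool) :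
    glueSpecies (speciesRot X) (g ∘ arcRot) = relComap segRot (glueSpecies X g) := by
  unfold glueSpecies
  rw [← fuse_rot]
  congr 1
  funext u v
  exact chainRel_rot X g u v

/-- Quarter-turn invariance of Langlands' `Θ_A`. [cite: LanglandsPouliotSaintaubin1994, §2.3] -/
theorem langlandsGlue_rot (M : Fin 4 → ArcRel k) :
    langlandsGlue (speciesRot M) = relComap segRot (langlandsGlue M) := by
  show glueSpecies _ ((fun _ => true) ∘ arcRot) = _
  exact glueSpecies_rot M fun _ => true

/-- **Quarter-turn equivariance** of the planar coin-resolved gluing: turning the `2 × 2` picture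
(quadrant `q` receives the turned state of quadrant `q + 1`) and the coins (arc `(h, j)` receives
the coin of arc `(h + 1, j)`) turns the output. [folklore] -/
theorem planarCoinGlue_rot (S : Fin 4 → BoxArcState k) (ξ : Fin 4 × Fin k → Bool) :
    planarCoinGlue (fun q => (S (q + 1)).rot) (ξ ∘ arcRot) = (planarCoinGlue S ξ).rot := by
  ext : 1
  · show glueSpecies (speciesRot fun q => (S q).primal)
        (gate (speciesRot fun q => (S q).primal) (speciesRot fun q => (S q).dual) (ξ ∘ arcRot)) =
      relComap segRot (glueSpecies (fun q => (S q).primal)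
        (gate (fun q => (S q).primal) (fun q => (S q).dual) ξ))
    rw [gate_rot, glueSpecies_rot]
  · show glueSpecies (speciesRot fun q => (S q).dual)
        (gate (speciesRot fun q => (S q).dual) (speciesRot fun q => (S q).primal)
          ((fun a => !ξ a) ∘ arcRot)) =
      relComap segRot (glueSpecies (fun q => (S q).dual)
        (gate (fun q => (S q).dual) (fun q => (S q).primal) fun a => !ξ a))
    rw [gate_rot, glueSpecies_rot]

/-! ### Reflection equivariance (with the quarter turn this gives the whole dihedral group) -/

/-- The reflection on segment indices as a permutation (an involution). [folklore] -/
def segReflEquiv : Fin 4 × Fin k ≃ Fin 4 × Fin k where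
  toFun := segRefl
  invFun := segRefl
  left_inv a := by simp [segRefl]
  right_inv a := by simp [segRefl]

/-- The reflection on nodes: quadrant `q ↦ 1 - q` (SW ↔ SE, NW ↔ NE), segment `segRefl`.
[folklore] -/
def nodeRefl : GlueNode k ≃ GlueNode k where
  toFun x := (1 - x.1, segRefl x.2)
  invFun x := (1 - x.1, segRefl x.2)
  left_inv x := by simp [segRefl]
  right_inv x := by simp [segRefl]

/-- The reflection on arc (and coin) indices: half-seam `h ↦ -h`, distance from the centre
unchanged. [folklore] -/
def arcRefl : Fin 4 × Fin k ≃ Fin 4 × Fin k where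
  toFun a := (-a.1, a.2)
  invFun a := (-a.1, a.2)
  left_inv a := by simp
  right_inv a := by simp

/-- Unfolding `nodeRefl`. [folklore] -/
@[simp] theorem nodeRefl_apply (x : GlueNode k) : nodeRefl x = (1 - x.1, segRefl x.2) := rfl

/-- Unfolding `arcRefl`. [folklore] -/
@[simp] theorem arcRefl_apply (a : Fin 4 × Fin k) : arcRefl a = (-a.1, a.2) := rfl

/-- Unfolding `segReflEquiv`. [folklore] -/
@[simp] theorem segReflEquiv_apply (a : Fin 4 × Fin k) : segReflEquiv a = segRefl a := rfl

/-- Unfolding `segRefl`. [folklore] -/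
@[simp] theorem segRefl_apply (a : Fin 4 × Fin k) : segRefl a = (-a.1, a.2.rev) := rfl

/-- The reflection exchanges the two endpoints of an arc: first ↦ second of the reflected arc.
[folklore] -/
theorem nodeRefl_arcFst (a : Fin 4 × Fin k) : nodeRefl (arcFst a) = arcSnd (arcRefl a) := by
  have h1 : ∀ h : Fin 4, 1 - h = -h + 1 := by decide
  have h2 : ∀ h : Fin 4, -(h + 1) = -h + 3 := by decide
  simp [arcFst, arcSnd, h1, h2]

/-- The reflection exchanges the two endpoints of an arc: second ↦ first of the reflected arc.
[folklore] -/
theorem nodeRefl_arcSnd (a : Fin 4 × Fin k) : nodeRefl (arcSnd a) = arcFst (arcRefl a) := by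
  have h1 : ∀ h : Fin 4, 1 - (h + 1) = -h := by decide
  have h2 : ∀ h : Fin 4, -(h + 3) = -h + 1 := by decide
  simp [arcFst, arcSnd, h1, h2]

/-- The reflection maps outer half-segment `(d, p)` to `(-d, rev p)`. [folklore] -/
theorem nodeRefl_outerNode (u : Fin 4 × Fin (2 * k)) :
    nodeRefl (outerNode u) = outerNode (-u.1, u.2.rev) := by
  have h1 : ∀ d : Fin 4, 1 - (d + 1) = -d := by decide
  have h2 : ∀ d : Fin 4, 1 - d = -d + 1 := by decide
  unfold outerNode
  by_cases h : (u.2 : ℕ) < k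
  · have h' : ¬ ((u.2.rev : Fin (2 * k)) : ℕ) < k := by
      rw [Fin.val_rev]; omega
    simp only [h, h', dite_true, dite_false, nodeRefl_apply, segRefl_apply, h2, Prod.mk.injEq,
      true_and]
    ext
    simp [Fin.val_rev]
    omega
  · have h' : ((u.2.rev : Fin (2 * k)) : ℕ) < k := by
      rw [Fin.val_rev]; omega
    simp only [h, h', dite_true, dite_false, nodeRefl_apply, segRefl_apply, h1, Prod.mk.injEq,
      true_and]
    ext
    simp [Fin.val_rev]
    omega

/-- The four matrices of one species seen after the reflection of the `2 × 2` picture: quadrant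
`q` carries the reflected matrix of quadrant `1 - q`. [folklore] -/
def speciesRefl (X : Fin 4 → ArcRel k) :
    Fin 4 → ArcRel k :=
  fun q => relComap segRefl (X (1 - q))

/-- The links of the reflected picture are the reflected links. [folklore] -/
theorem glueLink_refl (X : Fin 4 → ArcRel k) (g : Fin 4 × Fin k → Bool)
    (x y : GlueNode k) :
    GlueLink (speciesRefl X) (g ∘ arcRefl) x y ↔ GlueLink X g (nodeRefl x) (nodeRefl y) := by
  unfold GlueLink
  apply or_congr
  · simp [speciesRefl]
  · refine arcRefl.exists_congr fun a => ?_
    simp only [Function.comp_apply, ← nodeRefl_arcFst, ← nodeRefl_arcSnd,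
      nodeRefl.apply_eq_iff_eq]
    exact and_congr_right fun _ => or_comm

/-- `Passes` is reflected along with the picture. [folklore] -/
theorem passes_refl (X : Fin 4 → ArcRel k) (x : GlueNode k) :
    Passes (speciesRefl X) x ↔ Passes X (nodeRefl x) := by
  have hinj : Function.Injective (segRefl (k := k)) := segReflEquiv.injective
  refine segReflEquiv.exists_congr fun y => ?_
  simp only [speciesRefl, relComap_apply, nodeRefl_apply, segReflEquiv_apply]
  exact and_congr_left' (hinj.ne_iff (x := y) (y := x.2)).symm

/-- An arc of the reflected picture is contested iff the reflected arc is. [folklore] -/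
theorem contested_refl (X Y : Fin 4 → ArcRel k)
    (a : Fin 4 × Fin k) :
    Contested (speciesRefl X) (speciesRefl Y) a ↔ Contested X Y (arcRefl a) := by
  simp only [Contested, passes_refl, nodeRefl_arcFst, nodeRefl_arcSnd]
  exact and_congr and_comm and_comm

/-- The gates of the reflected picture with reflected coins are the reflected gates.
[folklore] -/
theorem gate_refl (X Y : Fin 4 → ArcRel k)
    (ξ : Fin 4 × Fin k → Bool) :
    gate (speciesRefl X) (speciesRefl Y) (ξ ∘ arcRefl) = gate X Y ξ ∘ arcRefl := by
  classical
  funext a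
  simp only [gate, Function.comp_apply, contested_refl]

/-- The chained outer relation of the reflected picture is the reflected chained relation.
[folklore] -/
theorem chainRel_refl (X : Fin 4 → ArcRel k)
    (g : Fin 4 × Fin k → Bool) (u v : Fin 4 × Fin (2 * k)) :
    chainRel (speciesRefl X) (g ∘ arcRefl) u v =
      chainRel X g (-u.1, u.2.rev) (-v.1, v.2.rev) := by
  classical
  unfold chainRel
  rw [← nodeRefl_outerNode, ← nodeRefl_outerNode]
  refine decide_eq_decide.mpr ?_
  exact eqvGen_iff_of_equiv nodeRefl (glueLink_refl X g) _ _

/-- The halves of a fused segment are reflected onto the halves of the reflected segment.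
[folklore] -/
theorem rev_dbl (t : Fin k) (i : Fin 2) : (dbl t i).rev = dbl t.rev i.rev := by
  ext
  simp only [dbl, Fin.val_rev]
  omega

/-- Fusion commutes with the reflection. [folklore] -/
theorem fuse_refl (R : ArcRel (2 * k)) :
    fuse (fun u v => R (-u.1, u.2.rev) (-v.1, v.2.rev)) = relComap segRefl (fuse R) := by
  funext a b
  simp only [fuse, relComap_apply, segRefl_apply, rev_dbl]
  refine decide_eq_decide.mpr ?_
  constructor
  · rintro ⟨i, j, h⟩
    exact ⟨i.rev, j.rev, h⟩
  · rintro ⟨i, j, h⟩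
    exact ⟨i.rev, j.rev, by simpa only [Fin.rev_rev] using h⟩

/-- Reflection equivariance of the one-species gluing. [folklore] -/
theorem glueSpecies_refl (X : Fin 4 → ArcRel k)
    (g : Fin 4 × Fin k → Bool) :
    glueSpecies (speciesRefl X) (g ∘ arcRefl) = relComap segRefl (glueSpecies X g) := by
  unfold glueSpecies
  rw [← fuse_refl]
  congr 1
  funext u v
  exact chainRel_refl X g u v

/-- Reflection invariance of Langlands' `Θ_A`. [cite: LanglandsPouliotSaintaubin1994, §2.3] -/
theorem langlandsGlue_refl (M : Fin 4 → ArcRel k) :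
    langlandsGlue (speciesRefl M) = relComap segRefl (langlandsGlue M) := by
  show glueSpecies _ ((fun _ => true) ∘ arcRefl) = _
  exact glueSpecies_refl M fun _ => true

/-- **Reflection equivariance** of the planar coin-resolved gluing: reflecting the `2 × 2`
picture in the vertical axis (quadrant `q` receives the reflected state of quadrant `1 - q`) and
the coins (arc `(h, j)` receives the coin of arc `(-h, j)`) reflects the output. Together with
`planarCoinGlue_rot` this is equivariance under the dihedral group of the square. [folklore] -/
theorem planarCoinGlue_refl (S : Fin 4 → BoxArcState k) (ξ : Fin 4 × Fin k → Bool) :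
    planarCoinGlue (fun q => (S (1 - q)).refl) (ξ ∘ arcRefl) = (planarCoinGlue S ξ).refl := by
  ext : 1
  · show glueSpecies (speciesRefl fun q => (S q).primal)
        (gate (speciesRefl fun q => (S q).primal) (speciesRefl fun q => (S q).dual)
          (ξ ∘ arcRefl)) =
      relComap segRefl (glueSpecies (fun q => (S q).primal)
        (gate (fun q => (S q).primal) (fun q => (S q).dual) ξ))
    rw [gate_refl, glueSpecies_refl]
  · show glueSpecies (speciesRefl fun q => (S q).dual)
        (gate (speciesRefl fun q => (S q).dual) (speciesRefl fun q => (S q).primal)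
          ((fun a => !ξ a) ∘ arcRefl)) =
      relComap segRefl (glueSpecies (fun q => (S q).dual)
        (gate (fun q => (S q).dual) (fun q => (S q).primal) fun a => !ξ a))
    rw [gate_refl, glueSpecies_refl]

/-! ### The glued matrices are symmetric -/

/-- The chained outer relation is symmetric. [folklore] -/
theorem chainRel_comm (X : Fin 4 → ArcRel k)
    (g : Fin 4 × Fin k → Bool) (u v : Fin 4 × Fin (2 * k)) :
    chainRel X g u v = chainRel X g v u := by
  classical
  unfold chainRel
  exact decide_eq_decide.mpr ⟨fun h => h.symm _ _, fun h => h.symm _ _⟩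

/-- The one-species gluing produces symmetric matrices (whatever the inputs). [folklore] -/
theorem glueSpecies_comm (X : Fin 4 → ArcRel k)
    (g : Fin 4 × Fin k → Bool) (a b : Fin 4 × Fin k) :
    glueSpecies X g a b = glueSpecies X g b a := by
  simp only [glueSpecies, fuse]
  refine decide_eq_decide.mpr ?_
  constructor
  · rintro ⟨i, j, h⟩
    exact ⟨j, i, by rw [chainRel_comm]; exact h⟩
  · rintro ⟨i, j, h⟩
    exact ⟨j, i, by rw [chainRel_comm]; exact h⟩

/-- Both output matrices of `planarCoinGlue` are symmetric. [folklore] -/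
theorem planarCoinGlue_symm (S : Fin 4 → BoxArcState k) (ξ : Fin 4 × Fin k → Bool)
    (a b : Fin 4 × Fin k) :
    (planarCoinGlue S ξ).primal a b = (planarCoinGlue S ξ).primal b a ∧
      (planarCoinGlue S ξ).dual a b = (planarCoinGlue S ξ).dual b a :=
  ⟨glueSpecies_comm _ _ a b, glueSpecies_comm _ _ a b⟩

/-! ### Packaging for the gluing RDE: symmetries as equivalences, slot and coin relabellings -/

/-- Quadrant relabelling under the quarter turn: `q ↦ q + 1`. [folklore] -/
def quadRot : Equiv.Perm (Fin 4) where
  toFun q := q + 1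
  invFun q := q - 1
  left_inv q := by simp
  right_inv q := by simp

/-- Quadrant relabelling under the reflection: `q ↦ 1 - q`. [folklore] -/
def quadRefl : Equiv.Perm (Fin 4) where
  toFun q := 1 - q
  invFun q := 1 - q
  left_inv q := by simp
  right_inv q := by simp

/-- Coin relabelling under the quarter turn: `ξ ↦ ξ ∘ arcRot`. [folklore] -/
def coinRot : (Fin 4 × Fin k → Bool) ≃ (Fin 4 × Fin k → Bool) where
  toFun ξ := ξ ∘ arcRot
  invFun ξ := ξ ∘ arcRot.symm
  left_inv ξ := by ext a; simp only [Function.comp_apply, Equiv.apply_symm_apply]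
  right_inv ξ := by ext a; simp only [Function.comp_apply, Equiv.symm_apply_apply]

/-- Coin relabelling under the reflection: `ξ ↦ ξ ∘ arcRefl`. [folklore] -/
def coinRefl : (Fin 4 × Fin k → Bool) ≃ (Fin 4 × Fin k → Bool) where
  toFun ξ := ξ ∘ arcRefl
  invFun ξ := ξ ∘ arcRefl.symm
  left_inv ξ := by ext a; simp only [Function.comp_apply, Equiv.apply_symm_apply]
  right_inv ξ := by ext a; simp only [Function.comp_apply, Equiv.symm_apply_apply]

/-- Coin relabelling under duality: negate every coin. [folklore] -/
def coinNot : (Fin 4 × Fin k → Bool) ≃ (Fin 4 × Fin k → Bool) where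
  toFun ξ a := !ξ a
  invFun ξ a := !ξ a
  left_inv ξ := by ext a; simp
  right_inv ξ := by ext a; simp

namespace BoxArcState

/-- The quarter turn as a permutation of the state space. [folklore] -/
def rotEquiv : BoxArcState k ≃ BoxArcState k where
  toFun := rot
  invFun s := s.rot.rot.rot
  left_inv s := rot_rot_rot_rot s
  right_inv s := rot_rot_rot_rot s

/-- The reflection as a permutation (involution) of the state space. [folklore] -/
def reflEquiv : BoxArcState k ≃ BoxArcState k where
  toFun := refl
  invFun := refl
  left_inv := refl_refl
  right_inv := refl_refl

/-- The duality involution as a permutation of the state space. [folklore] -/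
def swapEquiv : BoxArcState k ≃ BoxArcState k where
  toFun := swap
  invFun := swap
  left_inv := swap_swap
  right_inv := swap_swap

/-- Unfolding `rotEquiv`. [folklore] -/
@[simp] theorem rotEquiv_apply (s : BoxArcState k) : rotEquiv s = s.rot := rfl

/-- Unfolding `reflEquiv`. [folklore] -/
@[simp] theorem reflEquiv_apply (s : BoxArcState k) : reflEquiv s = s.refl := rfl

/-- Unfolding `swapEquiv`. [folklore] -/
@[simp] theorem swapEquiv_apply (s : BoxArcState k) : swapEquiv s = s.swap := rfl

/-- Generators of the symmetry group `D₄ × ℤ/2` of the state space (dihedral group of the square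
times duality): the quarter turn, the reflection in the vertical axis, the duality involution.
A law is invariant under the group iff it is invariant under these three maps. [folklore] -/
def symmetryGen (k : ℕ) : Fin 3 → BoxArcState k ≃ BoxArcState k :=
  ![rotEquiv, reflEquiv, swapEquiv]

end BoxArcState

end Juxtaposition

end Literature.Probability.Percolation
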